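import Summits.CriticalPhenomena.SAWScalingLimit.Theorems.SAWLeftRightFKGFKGToTraversalBoundSlitNecklaceDefs
import Summits.CriticalPhenomena.SAWScalingLimit.Theorems.SAWLeftRightFKGFKGToTraversalBoundNecklaceBookkeeping
import Summits.CriticalPhenomena.SAWScalingLimit.Theorems.SAWLeftRightFKGFKGToTraversalBoundSlitNecklaceFarTipU
import Summits.CriticalPhenomena.SAWScalingLimit.Theorems.SAWLeftRightFKGFKGToTraversalBoundSlotLaw
import Summits.CriticalPhenomena.SAWScalingLimit.Theorems.SAWLeftRightFKGFKGToTraversalBoundNecklaceAssemblyFar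
import Summits.CriticalPhenomena.SAWScalingLimit.Theorems.SAWLeftRightFKGFKGToTraversalBoundWitnessFinal
import Summits.CriticalPhenomena.SAWScalingLimit.Theorems.SAWLeftRightFKGFKGToTraversalBoundBBBudget
import HarnessLib

/-!
# Line `slit-necklace` of crux `FKGToTraversalBound` (stmt-CriticalPhenomena-1878): the TAME NECKLACE REDUCTION, closed

Lead prover-line-stmt-CriticalPhenomena-1878-c5-0, 2026-08-17.  This file discharges two registered stubs of the line skeleton
`Cruxes/FKGToTraversalBound/Lines/slit_necklace.lean` as unconditional / glue theorems of the tree: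

* `stub_necklaceWitnessFarU : NecklaceWitnessFarU` — the line's own hard lemma, the PLANAR FAR-TIP WITNESS in rank-uniform form
  (`Theorems/…SlitNecklaceFarTipU.lean`, p137250): composition of the witness glue
  `necklaceWitnessFarU_of_boundaryBudget` (p154966, `…WitnessFinal.lean`, over the outline-tour / window / obstacle / accounting
  files of waves 1–5) with the BOUNDARY BUDGET `stub_boundaryBudget` (p159748, `…BBBudget.lean`, over the feet / round connectors /
  body refinement / face chain / four-point / cyclic files of wave 6).  Rider: the per-shell form `necklaceWitnessFar_holds`.
* `stub_slitNecklace` — the SLIT NECKLACE (registered interface of the line): hung presentation + uniform sub-shell tightness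
  (the engine's output) + eventual tameness + germ tightness at both marked points ⇒ per-shell eventual tightness; glue over
  the landed assembly `stub_necklaceAssemblyFarU` (p138356), the slot law `stub_slotLaw` (p134383), the bookkeeping
  `stub_necklaceBookkeeping` (p130309) and the witness above.  Rider `necklaceReduction_tame`: the same without the (discharged,
  p127603) hung-presentation hypothesis — the TAME case of the route child `NecklaceReduction` of the strategist's split
  (`Cruxes/FKGToTraversalBound/SplitGlue.lean`, `DECOMPOSITION.md`): `UniformSubshellTight → ∀ D a b, IsEndpointApprox D a b →
  EventuallyTame D → GermTight D a b a → GermTight D a b b → EventualShellTight D a b`.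

What remains of the crux after this file (skeleton r4.3): `stub_engine` (= child `BubbleFKGEngine`, the R1 engine from left–right
PA and the bubble), `stub_criticalBubble` (= stmt-CriticalPhenomena-7117), `stub_germTight` (= child `GermTightness`) and
`stub_wildDomains` (the wild-domain case of `NecklaceReduction`) — none of them this line's mechanism.
-/

noncomputable section

open MeasureTheory Filter Topology Set Metric
open scoped NNReal ENNReal
open Literature.Probability.LatticeModels
open Literature.Probability.RandomPlanarGeometry
open Literature.Probability.RandomPlanarGeometry.SAW

namespace Summit.CriticalPhenomena.SAWScalingLimit.Theorems.FKGToTraversalBound.SlitNecklace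

/-- **The planar far-tip witness, rank-uniform form** (registered stub `stub_necklaceWitnessFarU` of line `slit-necklace`):
for every Dobrushin domain a boundary-budget function of the shell and, for every finite family of genuine shells, eventually in
the mesh, one rank on the far pieces of every presented chord such that at every shell of the family whose band is `2η`-far from
the marked centres, each far-tip piece whose lower-rank far pieces have `≤ W` windows across the `2δ`-thinner shell has a
self-avoiding route between its two far tips in `D_δ`, avoiding the spine and the rest of the chord, with
`< 8 (#far + #S + 2)² (W + nB + 2)` separated windows.  Witness glue (p154966) ∘ boundary budget (p159748). -/
theorem stub_necklaceWitnessFarU : NecklaceWitnessFarU :=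
  necklaceWitnessFarU_of_boundaryBudget stub_boundaryBudget

/-- The per-shell far-tip witness `NecklaceWitnessFar` (r4 form) from the rank-uniform one (glue p137250). -/
theorem necklaceWitnessFar_holds : NecklaceWitnessFar :=
  necklaceWitnessFar_of_uniform stub_necklaceWitnessFarU

/-- **The slit necklace** (registered stub `stub_slitNecklace` of line `slit-necklace`, its interface to the crux skeleton):
hung presentation + the engine's uniform sub-shell tightness + eventual tameness of the domain + germ tightness at both marked
points ⇒ per-shell eventual tightness of the traversal counts.  Glue over the landed far assembly (p138356), slot law (p134383),
bookkeeping (p130309) and the planar witness `stub_necklaceWitnessFarU`; the hung-presentation hypothesis is not even used (it is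
discharged inside the assembly by `stub_hungPresentation`, p127603). -/
theorem stub_slitNecklace :
    HungPresentation → UniformSubshellTight →
      ∀ (D : DobrushinDomain) (a b : ℝ → Site 2), IsEndpointApprox D a b → EventuallyTame D →
        GermTight D a b a → GermTight D a b b → EventualShellTight D a b :=
  fun _ h₂ => stub_necklaceAssemblyFarU stub_slotLaw stub_necklaceBookkeeping stub_necklaceWitnessFarU h₂

/-- **The tame necklace reduction** (the tame case of the route child `NecklaceReduction` of crux `FKGToTraversalBound`):
uniform sub-shell tightness over the r2 family (the engine's output) gives, on every EVENTUALLY TAME Dobrushin domain and for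
every endpoint approximation that is germ-tight at both marked points, per-shell eventual tightness of the traversal counts —
PA-free and bubble-free. -/
theorem necklaceReduction_tame :
    UniformSubshellTight →
      ∀ (D : DobrushinDomain) (a b : ℝ → Site 2), IsEndpointApprox D a b → EventuallyTame D →
        GermTight D a b a → GermTight D a b b → EventualShellTight D a b :=
  stub_necklaceAssemblyFarU stub_slotLaw stub_necklaceBookkeeping stub_necklaceWitnessFarU

end Summit.CriticalPhenomena.SAWScalingLimit.Theorems.FKGToTraversalBound.SlitNecklace

end
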